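import Summits.AtomisticToContinuum.Crystallization.Theses.HolmgrenBoyleLind
import Summits.AtomisticToContinuum.Crystallization.Theorems.PalmUnimodularRigidityCruxesToPalmRigidity
import Literature.Probability.Process.PointStationaryLaw

/-!
# Crux `HolmgrenBoyleLind.GroundStatesChargeFLCEquilibrium` (stmt-AtomisticToContinuum-6076):
# law-level re-basing — charging of a patch pattern does not depend on the base point

The content stub `stub_minimisingLawsChargeFLC` of the line `registered` asks that a minimising
point-stationary hard-core law `P` charge, at every scale `(R, ε)` and at ONE base point `q₀ ∈ Λ`,
the two-way matching event "after a linear isometry `A`, the atoms of `ν` in the ball of radius `R`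
are `ε`-matched with `A (Λ − q₀)`". This file records the law-level analogue of the re-basing step
of the force-balance transfer (`stub_nearFieldTransfer`): for every point-stationary law carried by
rooted hard-core configurations, a pattern `Λ` charged at one base point `q₀` at every scale is
charged at EVERY base point `q ∈ Λ` at every scale.

* `measure_ne_zero_of_ae_exists_reroot` — positive-probability mass transport: if `P T ≠ 0` and
  a.s. every configuration of `T` has an atom `y` whose re-rooted configuration `θ_y μ = μ.map (· − y)`
  lies in `T'`, then `P T' ≠ 0` (contrapositive of "everything shows at the root",
  `PalmUnimodularRigidity.ae_forall_map_sub_of_ae`; no measurability of `T, T'` is needed);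
* `map_sub_apply_singleton` — the atoms of `θ_y μ` are the atoms of `μ` shifted by `−y`;
* `charged_rebase` — the re-basing theorem (event at `q₀` with radius `R + dist q q₀ + 1` and
  tolerance `min (ε/2) 1`, re-rooted at the atom matched to `A (q − q₀)`, lies in the event at `q`
  with radius `R`, tolerance `ε`, same isometry: two triangle inequalities).

Consequence: in `stub_minimisingLawsChargeFLC` the clause `∃ q₀ ∈ Λ` is equivalent to `∀ q₀ ∈ Λ`.
All `[folklore]` (Aldous–Lyons 2007 §2 mass-transport principle); helper file for item
stmt-AtomisticToContinuum-6076, nothing here closes an item.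
-/

noncomputable section

open MeasureTheory Filter
open scoped ENNReal Topology

namespace Summit.AtomisticToContinuum.Crystallization.Theorems.HolmgrenBoyleLindGroundStatesChargeFLCEquilibrium

open Literature.Probability.Process

/-- **Positive-probability mass transport.** Let `P` be a law on configurations of `ℝ³` that is
point-stationary (Mecke identity, inlined) and a.s. a rooted `δ`-hard-core counting measure
(`δ > 0`). If an event `T` has `P T ≠ 0` and a.s. every `μ ∈ T` has an atom `y` with
`μ.map (· − y) ∈ T'`, then `P T' ≠ 0`. Proof: otherwise a.s. `μ ∉ T'`, hence ("everything shows at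
the root", `ae_forall_map_sub_of_ae`, using local finiteness of hard-core configurations) a.s. no
re-rooting of `μ` lies in `T'`, so a.s. `μ ∉ T`. [folklore] -/
theorem measure_ne_zero_of_ae_exists_reroot {P : Measure (Measure (EuclideanSpace ℝ (Fin 3)))}
    {δ : ℝ} (hδ : 0 < δ)
    (hcore : ∀ᵐ μ ∂P, (∃ S : Set (EuclideanSpace ℝ (Fin 3)), (0 : EuclideanSpace ℝ (Fin 3)) ∈ S ∧
      (∀ x ∈ S, ∀ y ∈ S, x ≠ y → δ ≤ dist x y) ∧
      μ = (Measure.count : Measure (EuclideanSpace ℝ (Fin 3))).restrict S))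
    (hstat : ∀ g : Measure (EuclideanSpace ℝ (Fin 3)) → EuclideanSpace ℝ (Fin 3) → ENNReal,
      Measurable (Function.uncurry g) →
      ∫⁻ μ, ∫⁻ y, g μ y ∂μ ∂P = ∫⁻ μ, ∫⁻ y, g (Measure.map (fun z => z - y) μ) (-y) ∂μ ∂P)
    {T T' : Set (Measure (EuclideanSpace ℝ (Fin 3)))} (hT : P T ≠ 0)
    (hTT' : ∀ᵐ μ ∂P, μ ∈ T → ∃ y : EuclideanSpace ℝ (Fin 3), μ {y} ≠ 0 ∧
      Measure.map (fun z => z - y) μ ∈ T') :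
    P T' ≠ 0 := by
  intro h0
  have hlf : ∀ᵐ μ ∂P, ∀ n : ℕ, μ ((fun z : EuclideanSpace ℝ (Fin 3) => ⌊‖z‖⌋₊) ⁻¹' {n}) < ∞ := by
    filter_upwards [hcore] with μ hμ n
    obtain ⟨S, -, hsep, rfl⟩ := hμ
    exact PalmUnimodularRigidity.count_restrict_floorNorm_preimage_lt_top hδ hsep n
  have hp : ∀ᵐ μ ∂P, μ ∉ T' := measure_eq_zero_iff_ae_notMem.1 h0
  have hall := PalmUnimodularRigidity.ae_forall_map_sub_of_ae hstat hlf hp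
  refine hT (measure_eq_zero_iff_ae_notMem.2 ?_)
  filter_upwards [hall, hTT'] with μ h1 h2 hμT
  obtain ⟨y, hy, hyT'⟩ := h2 hμT
  exact h1 y hy hyT'

/-- The atoms of the re-rooted configuration `θ_y μ = μ.map (· − y)` are the shifted atoms of `μ`:
`(θ_y μ) {p} = μ {p + y}`. [folklore] -/
theorem map_sub_apply_singleton (μ : Measure (EuclideanSpace ℝ (Fin 3)))
    (y p : EuclideanSpace ℝ (Fin 3)) :
    Measure.map (fun z => z - y) μ {p} = μ {p + y} := by
  rw [Measure.map_apply (measurable_sub_const y) (measurableSet_singleton p)]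
  congr 1
  ext z
  simp only [Set.mem_preimage, Set.mem_singleton_iff, sub_eq_iff_eq_add]

/-- **Re-basing at the law level.** Let `P` be point-stationary and a.s. a rooted `δ`-hard-core
counting measure (`δ > 0`), `Λ ⊂ ℝ³` any set and `q₀` any point. If for all `R, ε > 0` the two-way
matching event at the base point `q₀` — "for some linear isometry `A`, every `s ∈ Λ` with
`dist s q₀ ≤ R` has an atom within `ε` of `A (s − q₀)`, and every atom of norm `≤ R` is within `ε`
of some `A (s − q₀)`, `s ∈ Λ`" — has `P`-measure `≠ 0`, then the same holds at every base point
`q ∈ Λ`. Proof: a configuration in the event at `q₀` with radius `R + dist q q₀ + 1` and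
tolerance `ε' := min (ε/2) 1` has an atom `y` within `ε'` of `A (q − q₀)`; re-rooted at `y` it lies
in the event at `q` (radius `R`, tolerance `2ε' ≤ ε`, same `A`: `A (s − q) = A (s − q₀) − A (q − q₀)`
and two triangle inequalities); conclude by `measure_ne_zero_of_ae_exists_reroot`. [folklore] -/
theorem charged_rebase :
    ∀ (δ : ℝ), 0 < δ → ∀ (P : Measure (Measure (EuclideanSpace ℝ (Fin 3)))),
      (∀ᵐ μ ∂P, (∃ S : Set (EuclideanSpace ℝ (Fin 3)), (0 : EuclideanSpace ℝ (Fin 3)) ∈ S ∧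
        (∀ x ∈ S, ∀ y ∈ S, x ≠ y → δ ≤ dist x y) ∧
        μ = (Measure.count : Measure (EuclideanSpace ℝ (Fin 3))).restrict S)) →
      (∀ g : Measure (EuclideanSpace ℝ (Fin 3)) → EuclideanSpace ℝ (Fin 3) → ENNReal,
        Measurable (Function.uncurry g) →
        ∫⁻ μ, ∫⁻ y, g μ y ∂μ ∂P = ∫⁻ μ, ∫⁻ y, g (Measure.map (fun z => z - y) μ) (-y) ∂μ ∂P) →
      ∀ (Λ : Set (EuclideanSpace ℝ (Fin 3))) (q₀ : EuclideanSpace ℝ (Fin 3)),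
      (∀ R ε : ℝ, 0 < R → 0 < ε →
        P {ν : Measure (EuclideanSpace ℝ (Fin 3)) |
            ∃ A : EuclideanSpace ℝ (Fin 3) →ₗᵢ[ℝ] EuclideanSpace ℝ (Fin 3),
              (∀ s ∈ Λ, dist s q₀ ≤ R →
                ∃ p : EuclideanSpace ℝ (Fin 3), ν {p} ≠ 0 ∧ dist p (A (s - q₀)) ≤ ε) ∧
              (∀ p : EuclideanSpace ℝ (Fin 3), ν {p} ≠ 0 → ‖p‖ ≤ R →
                ∃ s ∈ Λ, dist p (A (s - q₀)) ≤ ε)} ≠ 0) →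
      ∀ q ∈ Λ, ∀ R ε : ℝ, 0 < R → 0 < ε →
        P {ν : Measure (EuclideanSpace ℝ (Fin 3)) |
            ∃ A : EuclideanSpace ℝ (Fin 3) →ₗᵢ[ℝ] EuclideanSpace ℝ (Fin 3),
              (∀ s ∈ Λ, dist s q ≤ R →
                ∃ p : EuclideanSpace ℝ (Fin 3), ν {p} ≠ 0 ∧ dist p (A (s - q)) ≤ ε) ∧
              (∀ p : EuclideanSpace ℝ (Fin 3), ν {p} ≠ 0 → ‖p‖ ≤ R →
                ∃ s ∈ Λ, dist p (A (s - q)) ≤ ε)} ≠ 0 := by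
  intro δ hδ P hcore hstat Λ q₀ hch q hq R ε hR hε
  -- tolerances and the enlarged radius
  set ε' : ℝ := min (ε / 2) 1 with hε'
  have hε'pos : 0 < ε' := lt_min (half_pos hε) one_pos
  have hε'ε : ε' + ε' ≤ ε := by
    have h := min_le_left (ε / 2) 1
    linarith
  have hε'1 : ε' ≤ 1 := min_le_right _ _
  set R' : ℝ := R + dist q q₀ + 1 with hR'
  have hR'pos : 0 < R' := by positivity
  refine measure_ne_zero_of_ae_exists_reroot hδ hcore hstat (hch R' ε' hR'pos hε'pos) ?_
  refine Filter.Eventually.of_forall fun μ hμ => ?_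
  obtain ⟨A, h1, h2⟩ := hμ
  -- the atom matched to `A (q − q₀)`
  have hqR' : dist q q₀ ≤ R' := by rw [hR']; linarith
  obtain ⟨y, hy, hyq⟩ := h1 q hq hqR'
  have hnAq : ‖A (q - q₀)‖ = dist q q₀ := by rw [LinearIsometry.norm_map, dist_eq_norm]
  have hny : ‖y‖ ≤ dist q q₀ + ε' := by
    calc ‖y‖ = dist y 0 := (dist_zero_right _).symm
      _ ≤ dist y (A (q - q₀)) + dist (A (q - q₀)) 0 := dist_triangle _ _ _
      _ ≤ ε' + dist q q₀ := by rw [dist_zero_right, hnAq]; exact add_le_add hyq le_rfl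
      _ = dist q q₀ + ε' := add_comm _ _
  have hAsq : ∀ s : EuclideanSpace ℝ (Fin 3), A (s - q) = A (s - q₀) - A (q - q₀) := by
    intro s
    rw [← map_sub]
    congr 1
    abel
  -- the key estimate: `dist (p − y) (A (s − q)) ≤ dist p (A (s − q₀)) + dist y (A (q − q₀))`
  have hkey : ∀ p s : EuclideanSpace ℝ (Fin 3),
      dist (p - y) (A (s - q)) ≤ dist p (A (s - q₀)) + dist y (A (q - q₀)) := by
    intro p s
    rw [hAsq, dist_eq_norm, dist_eq_norm, dist_eq_norm,
      show p - y - (A (s - q₀) - A (q - q₀)) = (p - A (s - q₀)) - (y - A (q - q₀)) by abel]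
    exact norm_sub_le _ _
  refine ⟨y, hy, A, fun s hs hsR => ?_, fun p' hp' hp'R => ?_⟩
  · -- points of `Λ` near `q` have matched atoms of the re-rooted configuration
    have hsR' : dist s q₀ ≤ R' := by
      have := dist_triangle s q q₀
      rw [hR']; linarith
    obtain ⟨p, hp, hps⟩ := h1 s hs hsR'
    refine ⟨p - y, ?_, ?_⟩
    · rwa [map_sub_apply_singleton, sub_add_cancel]
    · exact (hkey p s).trans ((add_le_add hps hyq).trans hε'ε)
  · -- atoms of the re-rooted configuration near the new root are matched
    rw [map_sub_apply_singleton] at hp'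
    have hnorm : ‖p' + y‖ ≤ R' := by
      calc ‖p' + y‖ ≤ ‖p'‖ + ‖y‖ := norm_add_le _ _
        _ ≤ R + (dist q q₀ + ε') := add_le_add hp'R hny
        _ ≤ R' := by rw [hR']; linarith
    obtain ⟨s, hs, hps⟩ := h2 (p' + y) hp' hnorm
    refine ⟨s, hs, ?_⟩
    have h := hkey (p' + y) s
    rw [add_sub_cancel_right] at h
    exact h.trans ((add_le_add hps hyq).trans hε'ε)

end Summit.AtomisticToContinuum.Crystallization.Theorems.HolmgrenBoyleLindGroundStatesChargeFLCEquilibrium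

end
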